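import Summits.AtomisticToContinuum.HydrodynamicLimit.Theorems.EquilibriumClampedCollisionalWindowLD.Negative.Records
import Summits.AtomisticToContinuum.HydrodynamicLimit.Theorems.EquilibriumClampedCollisionalWindowLD.Negative.TestFunction

/-!
# Record values (impulses, energies of the transfers); the energy functional from below (helper file of the refutation of `EquilibriumClampedCollisionalWindowLD`, stmt-AtomisticToContinuum-13733; see `Cruxes/EquilibriumClampedCollisionalWindowLD/Disproof.lean` and the evidence WITNESS.md; no Theses declaration is asserted positively; refuter-cdisprove-stmt-AtomisticToContinuum-13733-0)
-/

noncomputable section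

open Real
open scoped InnerProductSpace

namespace Summit.AtomisticToContinuum.HydrodynamicLimit.Theorems

namespace EquilibriumClampedCollisionalWindowLDNegative

section Lattice

open Literature.Analysis.FluidPDE Literature.Analysis.FunctionSpaces
open Filter
open scoped Topology

namespace Lat

variable {Λ : Lat} {N : ℕ} {a : Fin (N + 1) ≃ Λ.Slot}

section RecordValues

variable {Φ : HardSphereFlow (Torus.geometry (Fin 3)) Λ.P.ε (N + 1)}

/-- The data of a transfer: impulse `c`, normal `n`, carrier velocity `W`, target velocity `η`. -/
abbrev trC (Λ : Lat) {N : ℕ} (a : Fin (N + 1) ≃ Λ.Slot) (z : Cfg N) (tr : ℕ × (Fin Λ.n × Fin Λ.n) × ℕ) : ℝ :=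
  ck Λ.P (bv 0) (Λ.bdata a z tr.1 tr.2.1) tr.2.2
/-- normal of a transfer -/
abbrev trN (Λ : Lat) {N : ℕ} (a : Fin (N + 1) ≃ Λ.Slot) (z : Cfg N) (tr : ℕ × (Fin Λ.n × Fin Λ.n) × ℕ) : E3 :=
  nk Λ.P (bv 0) (Λ.bdata a z tr.1 tr.2.1) tr.2.2
/-- carrier velocity of a transfer -/
abbrev trW (Λ : Lat) {N : ℕ} (a : Fin (N + 1) ≃ Λ.Slot) (z : Cfg N) (tr : ℕ × (Fin Λ.n × Fin Λ.n) × ℕ) : E3 :=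
  (carrier Λ.P (bv 0) (Λ.bdata a z tr.1 tr.2.1) tr.2.2).W
/-- target velocity of a transfer -/
abbrev trη (Λ : Lat) {N : ℕ} (a : Fin (N + 1) ≃ Λ.Slot) (z : Cfg N) (tr : ℕ × (Fin Λ.n × Fin Λ.n) × ℕ) : E3 :=
  (Λ.bdata a z tr.1 tr.2.1).η (tr.2.2 + 1)

/-- **Post-collisional velocities of a transfer.** [folklore] -/
theorem cert_snd_transfer (hW : Λ.WinOK) {z : Cfg N} (hz : z ∈ Λ.Ev a) {tr : ℕ × (Fin Λ.n × Fin Λ.n) × ℕ}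
    (htr : tr ∈ Λ.transfers a z) :
    (Λ.cert a z (Λ.ttime a z tr) (Λ.sphI a tr)).2 = Λ.trW a z tr - Λ.trC a z tr • Λ.trN a z tr ∧
      (Λ.cert a z (Λ.ttime a z tr) (Λ.sphJ a tr)).2 = Λ.trη a z tr + Λ.trC a z tr • Λ.trN a z tr := by
  have hΛ := hW.ok
  have hP := hΛ.sep.adm
  obtain ⟨hb, hj, hact, -⟩ := mem_transfers.1 htr
  obtain ⟨f1, f2, f3⟩ := sphI_facts hΛ htr
  obtain ⟨g1, g2, g3⟩ := sphJ_facts hΛ htr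
  have hD := dataOK_of_mem hΛ hz hact tr.2.1
  have hvel := vel_at_transfer hP hD hj
  rw [cert_snd, cert_snd, certVel_active _ _ _ (f1 ▸ hact), certVel_active _ _ _ (g1 ▸ hact), f1, f2, f3, g1, g2, g3]
  exact hvel

/-- **Pre-collisional velocities of a transfer** (undoing the elastic jump). [folklore] -/
theorem preVel_transfer (hW : Λ.WinOK) {z : Cfg N} (hz : z ∈ Λ.Ev a) {tr : ℕ × (Fin Λ.n × Fin Λ.n) × ℕ}
    (htr : tr ∈ Λ.transfers a z) :
    (HardSphereCollisionRecord.ofConfig (Torus.geometry (Fin 3)) Λ.P.ε (Λ.cert a z (Λ.ttime a z tr))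
        (Λ.ttime a z tr) (Λ.sphI a tr) (Λ.sphJ a tr)).preVel = (Λ.trW a z tr, Λ.trη a z tr) ∧
    (HardSphereCollisionRecord.ofConfig (Torus.geometry (Fin 3)) Λ.P.ε (Λ.cert a z (Λ.ttime a z tr))
        (Λ.ttime a z tr) (Λ.sphJ a tr) (Λ.sphI a tr)).preVel = (Λ.trη a z tr, Λ.trW a z tr) := by
  have hΛ := hW.ok
  have hP := hΛ.sep.adm
  obtain ⟨hb, hj, hact, -⟩ := mem_transfers.1 htr
  have hD := dataOK_of_mem hΛ hz hact tr.2.1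
  have hn1 : ‖Λ.trN a z tr‖ = 1 := (stepFacts hP hD (by omega : tr.2.2 + 1 ≤ Λ.P.K)).cont.n_unit
  have hε0 : Λ.P.ε ≠ 0 := hP.ε_pos.ne'
  obtain ⟨hvi, hvj⟩ := cert_snd_transfer hW hz htr
  have hsv := sepVec_sph hW hz htr
  have hsv' : (Torus.geometry (Fin 3)).sepVec (Λ.cert a z (Λ.ttime a z tr) (Λ.sphJ a tr)).1
      (Λ.cert a z (Λ.ttime a z tr) (Λ.sphI a tr)).1 = Λ.P.ε • Λ.trN a z tr := by
    have hreg := regular hP (by have := hW.s_le; have := hP.ε_lt_s; linarith)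
    rw [hreg.sepVec_comm _ _ (by rw [hsv, norm_neg, norm_smul, hn1, mul_one, Real.norm_of_nonneg hP.ε_pos.le]),
      hsv, neg_neg]
  set c := Λ.trC a z tr
  set n := Λ.trN a z tr
  set W := Λ.trW a z tr
  set η := Λ.trη a z tr
  have hcdef : c = ⟪W - η, n⟫_ℝ := rfl
  have hnn : ⟪n, n⟫_ℝ = 1 := by rw [real_inner_self_eq_norm_sq, hn1, one_pow]
  have hc' : ⟪W, n⟫_ℝ - ⟪η, n⟫_ℝ = c := by rw [hcdef, inner_sub_left]
  have key1 : ⟪(W - c • n) - (η + c • n), n⟫_ℝ = -c := by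
    rw [inner_sub_left, inner_sub_left, inner_add_left, real_inner_smul_left, hnn]; linarith
  have key2 : ⟪(η + c • n) - (W - c • n), n⟫_ℝ = c := by
    rw [inner_sub_left, inner_add_left, inner_sub_left, real_inner_smul_left, hnn]; linarith
  constructor
  · simp only [HardSphereCollisionRecord.ofConfig_preVel, hsv, hvi, hvj]
    rw [reflectVel_neg_smul_unit hn1 hε0, key1]
    ext <;> simp
  · simp only [HardSphereCollisionRecord.ofConfig_preVel, hsv', hvi, hvj]
    rw [← reflectVel_neg (Λ.P.ε • n), reflectVel_neg_smul_unit hn1 hε0, key2]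
    ext <;> simp

/-- **Momentum impulses of a transfer**: both records carry the impulse `c`. [folklore] -/
theorem impulse_transfer (hW : Λ.WinOK) {z : Cfg N} (hz : z ∈ Λ.Ev a) {tr : ℕ × (Fin Λ.n × Fin Λ.n) × ℕ}
    (htr : tr ∈ Λ.transfers a z) :
    let rIJ := HardSphereCollisionRecord.ofConfig (Torus.geometry (Fin 3)) Λ.P.ε (Λ.cert a z (Λ.ttime a z tr))
        (Λ.ttime a z tr) (Λ.sphI a tr) (Λ.sphJ a tr)
    let rJI := HardSphereCollisionRecord.ofConfig (Torus.geometry (Fin 3)) Λ.P.ε (Λ.cert a z (Λ.ttime a z tr))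
        (Λ.ttime a z tr) (Λ.sphJ a tr) (Λ.sphI a tr)
    ‖rIJ.postVel.1 - rIJ.preVel.1‖ = Λ.trC a z tr ∧ ‖rJI.postVel.1 - rJI.preVel.1‖ = Λ.trC a z tr := by
  have hΛ := hW.ok
  have hP := hΛ.sep.adm
  obtain ⟨hb, hj, hact, -⟩ := mem_transfers.1 htr
  have hD := dataOK_of_mem hΛ hz hact tr.2.1
  have hf := stepFacts hP hD (by omega : tr.2.2 + 1 ≤ Λ.P.K)
  have hn1 : ‖Λ.trN a z tr‖ = 1 := hf.cont.n_unit
  have hc0 : 0 ≤ Λ.trC a z tr := (hP.clo_pos.trans_le hf.cont.c_ge).le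
  obtain ⟨hpi, hpj⟩ := preVel_transfer hW hz htr
  obtain ⟨hvi, hvj⟩ := cert_snd_transfer hW hz htr
  simp only [HardSphereCollisionRecord.ofConfig_postVel, hpi, hpj, hvi, hvj]
  constructor
  · rw [show Λ.trW a z tr - Λ.trC a z tr • Λ.trN a z tr - Λ.trW a z tr = -(Λ.trC a z tr • Λ.trN a z tr) by abel,
      norm_neg, norm_smul, hn1, mul_one, Real.norm_of_nonneg hc0]
  · rw [show Λ.trη a z tr + Λ.trC a z tr • Λ.trN a z tr - Λ.trη a z tr = Λ.trC a z tr • Λ.trN a z tr by abel,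
      norm_smul, hn1, mul_one, Real.norm_of_nonneg hc0]

/-- **Energy bookkeeping of a transfer**: the energy-row summands of the two records add up to
`(φ(x_J) - φ(x_I)) · (‖W'‖² - ‖η‖²)/2`. [folklore] -/
theorem energy_transfer (hW : Λ.WinOK) {z : Cfg N} (hz : z ∈ Λ.Ev a) {tr : ℕ × (Fin Λ.n × Fin Λ.n) × ℕ}
    (htr : tr ∈ Λ.transfers a z) (φ : UnitAddTorus (Fin 3) → ℝ) :
    let rIJ := HardSphereCollisionRecord.ofConfig (Torus.geometry (Fin 3)) Λ.P.ε (Λ.cert a z (Λ.ttime a z tr))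
        (Λ.ttime a z tr) (Λ.sphI a tr) (Λ.sphJ a tr)
    let rJI := HardSphereCollisionRecord.ofConfig (Torus.geometry (Fin 3)) Λ.P.ε (Λ.cert a z (Λ.ttime a z tr))
        (Λ.ttime a z tr) (Λ.sphJ a tr) (Λ.sphI a tr)
    (φ rIJ.fstPos - φ rIJ.sndPos) * ((‖rIJ.postVel.1‖ ^ 2 - ‖rIJ.preVel.1‖ ^ 2) / 2) / 2 +
      (φ rJI.fstPos - φ rJI.sndPos) * ((‖rJI.postVel.1‖ ^ 2 - ‖rJI.preVel.1‖ ^ 2) / 2) / 2 =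
    (φ (Λ.cert a z (Λ.ttime a z tr) (Λ.sphJ a tr)).1 - φ (Λ.cert a z (Λ.ttime a z tr) (Λ.sphI a tr)).1) *
      (‖Λ.trη a z tr + Λ.trC a z tr • Λ.trN a z tr‖ ^ 2 - ‖Λ.trη a z tr‖ ^ 2) / 2 := by
  have hΛ := hW.ok
  have hP := hΛ.sep.adm
  obtain ⟨hb, hj, hact, -⟩ := mem_transfers.1 htr
  have hD := dataOK_of_mem hΛ hz hact tr.2.1
  have hn1 : ‖Λ.trN a z tr‖ = 1 := (stepFacts hP hD (by omega : tr.2.2 + 1 ≤ Λ.P.K)).cont.n_unit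
  obtain ⟨hpi, hpj⟩ := preVel_transfer hW hz htr
  obtain ⟨hvi, hvj⟩ := cert_snd_transfer hW hz htr
  simp only [HardSphereCollisionRecord.ofConfig_postVel, HardSphereCollisionRecord.ofConfig_fstPos,
    HardSphereCollisionRecord.ofConfig_sndPos, hpi, hpj, hvi, hvj]
  -- pair energy conservation
  set c := Λ.trC a z tr
  set n := Λ.trN a z tr
  set W := Λ.trW a z tr
  set η := Λ.trη a z tr
  have hcdef : c = ⟪W - η, n⟫_ℝ := rfl
  have hcons : ‖W - c • n‖ ^ 2 - ‖W‖ ^ 2 = -(‖η + c • n‖ ^ 2 - ‖η‖ ^ 2) := by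
    rw [norm_sub_sq_real, norm_add_sq_real, real_inner_smul_right, real_inner_smul_right, norm_smul, hn1, mul_one,
      Real.norm_eq_abs, sq_abs]
    have : ⟪W, n⟫_ℝ - ⟪η, n⟫_ℝ = c := by rw [hcdef, inner_sub_left]
    have h2 : c * ⟪W, n⟫_ℝ - c * ⟪η, n⟫_ℝ = c ^ 2 := by rw [← mul_sub, this]; ring
    linarith
  rw [hcons]; ring

end RecordValues

end Lat

end Lattice

section Energy

open Literature.Analysis.FluidPDE Literature.Analysis.FunctionSpaces

namespace Lat

variable {Λ : Lat} {N : ℕ} {a : Fin (N + 1) ≃ Λ.Slot}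
variable {Φ : HardSphereFlow (Torus.geometry (Fin 3)) Λ.P.ε (N + 1)}

/-- **The energy functional with trivial clamp** as a sum over transfers. [folklore] -/
theorem energy_window_eq (hW : Λ.WinOK) (hε : Λ.P.ε < 1 / 2) {z : Cfg N} (hz : z ∈ Λ.Ev a) (hgood : z ∈ Φ.good)
    {ω : Fin (N + 1) → ℝ} (hω : ∀ i, ω i = 1) (φ : UnitAddTorus (Fin 3) → ℝ) :
    Φ.collisionSum (Set.Ioc 0 Λ.w)
        (fun c => ω c.fst * ω c.snd * ((φ c.fstPos - φ c.sndPos) * ((‖c.postVel.1‖ ^ 2 - ‖c.preVel.1‖ ^ 2) / 2)) / 2) z =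
      ∑ tr ∈ Λ.transfers a z,
        (φ (Λ.cert a z (Λ.ttime a z tr) (Λ.sphJ a tr)).1 - φ (Λ.cert a z (Λ.ttime a z tr) (Λ.sphI a tr)).1) *
          (‖Λ.trη a z tr + Λ.trC a z tr • Λ.trN a z tr‖ ^ 2 - ‖Λ.trη a z tr‖ ^ 2) / 2 := by
  rw [collisionSum_window hW hε hz hgood]
  refine Finset.sum_congr rfl fun tr htr => ?_
  have h := energy_transfer hW hz htr φ
  simp only [hω, one_mul] at h ⊢
  exact h

/-- The `x₀`-coordinate of the first sphere of a transfer lies in the active third. [folklore] -/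
theorem liftPos_sphI_range (hW : Λ.WinOK) {z : Cfg N} (hz : z ∈ Λ.Ev a) {tr : ℕ × (Fin Λ.n × Fin Λ.n) × ℕ}
    (htr : tr ∈ Λ.transfers a z) :
    7 / 12 - (Λ.P.errA + Λ.P.fwd) ≤ (Λ.liftPos a z (Λ.ttime a z tr) (Λ.sphI a tr)) 0 ∧
      (Λ.liftPos a z (Λ.ttime a z tr) (Λ.sphI a tr)) 0 ≤ 11 / 12 + (Λ.P.errA + Λ.P.fwd) := by
  have hΛ := hW.ok
  have hP := hΛ.sep.adm
  obtain ⟨hb, hj, hact, hw⟩ := mem_transfers.1 htr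
  have ht0 := (ttime_pos hΛ hz htr).le
  have hdev := liftPos_dev hW hz ht0 hw (Λ.sphI a tr)
  have hslot : (Λ.slotVec (a (Λ.sphI a tr))) 0 = ((tr.1 * Λ.m + tr.2.2 : ℕ) : ℝ) * Λ.P.s := by
    rw [slotVec_zero, sph_eq hΛ hb (by omega) tr.2.1]; rfl
  have hco : (Λ.liftPos a z (Λ.ttime a z tr) (Λ.sphI a tr) - Λ.slotVec (a (Λ.sphI a tr))) 0 =
      (Λ.liftPos a z (Λ.ttime a z tr) (Λ.sphI a tr)) 0 - ((tr.1 * Λ.m + tr.2.2 : ℕ) : ℝ) * Λ.P.s := by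
    rw [PiLp.sub_apply, hslot]
  have h1 := hdev.1
  have h2 := (le_abs_self _).trans ((abs_apply_le_norm _ 0).trans hdev.2)
  rw [hco] at h1 h2
  obtain ⟨-, hlo, hhi⟩ := hact
  have hs := hP.s_pos
  have hK := hΛ.K_eq
  have hjm : tr.2.2 + 1 ≤ Λ.m := by omega
  have hcast1 : ((tr.1 * Λ.m + tr.2.2 : ℕ) : ℝ) * Λ.P.s ≥ ((tr.1 * Λ.m : ℕ) : ℝ) * Λ.P.s := by
    refine mul_le_mul_of_nonneg_right ?_ hs.le; exact_mod_cast Nat.le_add_right _ _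
  have hcast2 : ((tr.1 * Λ.m + tr.2.2 : ℕ) : ℝ) * Λ.P.s ≤ (((tr.1 + 1) * Λ.m : ℕ) : ℝ) * Λ.P.s := by
    refine mul_le_mul_of_nonneg_right ?_ hs.le
    have : tr.1 * Λ.m + tr.2.2 ≤ (tr.1 + 1) * Λ.m := by rw [Nat.add_mul, one_mul]; omega
    exact_mod_cast this
  have he := e1_le_errA (Λ := Λ) hP
  have := hP.errA_nn
  constructor <;> linarith

/-- The normal of a transfer has first coordinate in `[1 - αn²/2, 1]`. [folklore] -/
theorem trN_zero (hΛ : Λ.OK) {z : Cfg N} (hz : z ∈ Λ.Ev a) {tr : ℕ × (Fin Λ.n × Fin Λ.n) × ℕ}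
    (htr : tr ∈ Λ.transfers a z) : 1 - Λ.P.αn ^ 2 / 2 ≤ Λ.trN a z tr 0 ∧ Λ.trN a z tr 0 ≤ 1 := by
  have hP := hΛ.sep.adm
  obtain ⟨hb, hj, hact, -⟩ := mem_transfers.1 htr
  have hD := dataOK_of_mem hΛ hz hact tr.2.1
  have hf := (stepFacts hP hD (by omega : tr.2.2 + 1 ≤ Λ.P.K)).cont
  have hn1 := hf.n_unit
  have hdir := hf.n_dir
  have hinner : Λ.trN a z tr 0 = ⟪Λ.trN a z tr, bv 0⟫_ℝ := (inner_bv _ _).symm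
  rw [hinner]
  constructor
  · -- polarization: `⟪n, e⟫ = 1 - ‖n - e‖²/2`
    have hpol : ⟪Λ.trN a z tr, bv 0⟫_ℝ = 1 - ‖Λ.trN a z tr - bv 0‖ ^ 2 / 2 := by
      rw [norm_sub_sq_real, hn1, norm_bv]; ring
    rw [hpol]
    have : ‖Λ.trN a z tr - bv 0‖ ^ 2 ≤ Λ.P.αn ^ 2 := pow_le_pow_left₀ (norm_nonneg _) hdir 2
    linarith
  · calc ⟪Λ.trN a z tr, bv 0⟫_ℝ ≤ ‖Λ.trN a z tr‖ * ‖bv 0‖ := real_inner_le_norm _ _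
      _ = 1 := by rw [hn1, norm_bv, mul_one]

/-- **Per-transfer gain.** [folklore] -/
theorem gain_transfer (hW : Λ.WinOK) (hG : Λ.GainOK) {z : Cfg N} (hz : z ∈ Λ.Ev a)
    {tr : ℕ × (Fin Λ.n × Fin Λ.n) × ℕ} (htr : tr ∈ Λ.transfers a z) :
    gainT Λ.P ≤ (phi (Λ.cert a z (Λ.ttime a z tr) (Λ.sphJ a tr)).1 - phi (Λ.cert a z (Λ.ttime a z tr) (Λ.sphI a tr)).1) *
      (‖Λ.trη a z tr + Λ.trC a z tr • Λ.trN a z tr‖ ^ 2 - ‖Λ.trη a z tr‖ ^ 2) / 2 := by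
  have hΛ := hW.ok
  have hP := hΛ.sep.adm
  obtain ⟨hb, hj, hact, hw⟩ := mem_transfers.1 htr
  have hD := dataOK_of_mem hΛ hz hact tr.2.1
  have hf := stepFacts hP hD (by omega : tr.2.2 + 1 ≤ Λ.P.K)
  have hn1 : ‖Λ.trN a z tr‖ = 1 := hf.cont.n_unit
  -- the positions: `x_J = x_I + ε n` in the lift
  obtain ⟨f1, f2, f3⟩ := sphI_facts hΛ htr
  obtain ⟨g1, g2, g3⟩ := sphJ_facts hΛ htr
  have hsb : Λ.SameBlk a (Λ.sphI a tr) (Λ.sphJ a tr) := ⟨f1 ▸ hact, by rw [f1, g1], by rw [f3, g3]⟩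
  have hdiff := liftPos_sub_sameBlk z (Λ.ttime a z tr) hsb
  rw [f1, f3, f2, g2] at hdiff
  have hcontact := adj_contact hP hD hj
  rw [show tHit Λ.P (bv 0) (Λ.bdata a z tr.1 tr.2.1) (tr.2.2 + 1) = Λ.ttime a z tr from rfl] at hcontact
  rw [hcontact] at hdiff
  -- so the `x₀`-coordinates differ by `ε n₀`
  set y := (Λ.liftPos a z (Λ.ttime a z tr) (Λ.sphI a tr)) 0 with hy
  set n₀ := Λ.trN a z tr 0 with hn₀
  have hyJ : (Λ.liftPos a z (Λ.ttime a z tr) (Λ.sphJ a tr)) 0 = y + Λ.P.ε * n₀ := by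
    have := congrArg (fun v : E3 => v 0) hdiff
    simp only [PiLp.sub_apply, PiLp.smul_apply, smul_eq_mul] at this
    rw [hy, hn₀]; linarith
  rw [cert_fst, cert_fst, phi_proj, phi_proj, hyJ]
  -- the cosine gain
  obtain ⟨hn₀lo, hn₀hi⟩ := trN_zero hΛ hz htr
  obtain ⟨hylo, hyhi⟩ := liftPos_sphI_range hW hz htr
  rw [← hn₀] at hn₀lo hn₀hi
  rw [← hy] at hylo hyhi
  have hε := hP.ε_pos
  have hαn1 : Λ.P.αn ≤ 1 := hΛ.sep.αn_le
  have hαn0 : 0 ≤ Λ.P.αn := hP.αn_nn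
  have h12 : 1 / 2 ≤ 1 - Λ.P.αn ^ 2 / 2 := by nlinarith
  have hn₀0 : 0 ≤ n₀ := by linarith
  have he0 : 0 ≤ Λ.P.ε * n₀ := by positivity
  have he1 : Λ.P.ε * n₀ ≤ Λ.P.ε := by nlinarith
  have hδ0 : 0 ≤ Λ.P.errA + Λ.P.fwd := by
    have := hP.errA_nn; have := (e1_le_errA (Λ := Λ) hP).2; linarith
  have hπ := Real.pi_pos
  have hπe : Real.pi * (Λ.P.ε * n₀) ≤ Real.pi * Λ.P.ε := mul_le_mul_of_nonneg_left he1 hπ.le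
  have hh : 2 * Real.pi * (Λ.P.errA + Λ.P.fwd) + Real.pi * (Λ.P.ε * n₀) ≤ 1 / 2 := by
    have := hG.h_le; linarith
  have hcos := cos_gain hδ0 hylo hyhi he0 hh
  -- Δφ ≥ A₀ ≥ 0
  set κ₀ := 2 - 4 * (2 * Real.pi * (Λ.P.errA + Λ.P.fwd) + Real.pi * Λ.P.ε) with hκ₀
  have hκ₀0 : 0 ≤ κ₀ := by rw [hκ₀]; linarith [hG.h_le]
  have hκle : κ₀ ≤ 2 - 4 * (2 * Real.pi * (Λ.P.errA + Λ.P.fwd) + Real.pi * (Λ.P.ε * n₀)) := by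
    rw [hκ₀]; linarith
  have hεn : Λ.P.ε * (1 - Λ.P.αn ^ 2 / 2) ≤ Λ.P.ε * n₀ := mul_le_mul_of_nonneg_left hn₀lo hε.le
  have hA0' : 0 ≤ Λ.P.ε * (1 - Λ.P.αn ^ 2 / 2) := mul_nonneg hε.le (by linarith)
  have hA : κ₀ * (Λ.P.ε * (1 - Λ.P.αn ^ 2 / 2)) ≤
      Real.cos (2 * Real.pi * (y + Λ.P.ε * n₀)) - Real.cos (2 * Real.pi * y) :=
    le_trans (mul_le_mul hκle hεn hA0' (hκ₀0.trans hκle)) hcos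
  have hA0 : 0 ≤ κ₀ * (Λ.P.ε * (1 - Λ.P.αn ^ 2 / 2)) := mul_nonneg hκ₀0 hA0'
  -- ΔE ≥ B₀ ≥ 0
  set c := Λ.trC a z tr with hc
  have hcge : Λ.P.clo ≤ c := hf.cont.c_ge
  have hη : ‖Λ.trη a z tr‖ ≤ Λ.P.u := hD.η_le (tr.2.2 + 1) (by omega) (by omega)
  have hu := hP.u_nn
  have hclo := hP.clo_pos
  have hc0 : 0 ≤ c := hclo.le.trans hcge
  have hexp : ‖Λ.trη a z tr + c • Λ.trN a z tr‖ ^ 2 - ‖Λ.trη a z tr‖ ^ 2 =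
      2 * (c * ⟪Λ.trη a z tr, Λ.trN a z tr⟫_ℝ) + c ^ 2 := by
    rw [norm_add_sq_real, real_inner_smul_right, norm_smul, hn1, mul_one, Real.norm_eq_abs, sq_abs]; ring
  have hin : -Λ.P.u ≤ ⟪Λ.trη a z tr, Λ.trN a z tr⟫_ℝ := by
    have h1 := abs_real_inner_le_norm (Λ.trη a z tr) (Λ.trN a z tr)
    rw [hn1, mul_one] at h1
    have := neg_abs_le (⟪Λ.trη a z tr, Λ.trN a z tr⟫_ℝ)
    linarith
  have hin' : c * (-Λ.P.u) ≤ c * ⟪Λ.trη a z tr, Λ.trN a z tr⟫_ℝ := mul_le_mul_of_nonneg_left hin hc0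
  have hmono : Λ.P.clo * (Λ.P.clo - 2 * Λ.P.u) ≤ c ^ 2 - 2 * (c * Λ.P.u) := by
    have h := mul_nonneg (sub_nonneg.2 hcge) (by linarith [hG.u_le] : 0 ≤ c + Λ.P.clo - 2 * Λ.P.u)
    nlinarith [h]
  have hB : Λ.P.clo * (Λ.P.clo - 2 * Λ.P.u) ≤ ‖Λ.trη a z tr + c • Λ.trN a z tr‖ ^ 2 - ‖Λ.trη a z tr‖ ^ 2 := by
    rw [hexp]; linarith
  have hB0 : 0 ≤ Λ.P.clo * (Λ.P.clo - 2 * Λ.P.u) := mul_nonneg hclo.le (by linarith [hG.u_le])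
  -- combine
  have := mul_le_mul hA hB hB0 (hA0.trans hA)
  have hg : gainT Λ.P = κ₀ * (Λ.P.ε * (1 - Λ.P.αn ^ 2 / 2)) * (Λ.P.clo * (Λ.P.clo - 2 * Λ.P.u)) / 2 := by
    rw [gainT, hκ₀]
  rw [hg]
  linarith

/-- **The energy functional from below.** [folklore] -/
theorem energy_lower (hW : Λ.WinOK) (hG : Λ.GainOK) (hε : Λ.P.ε < 1 / 2) {z : Cfg N} (hz : z ∈ Λ.Ev a)
    (hgood : z ∈ Φ.good) {ω : Fin (N + 1) → ℝ} (hω : ∀ i, ω i = 1) :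
    ((Λ.transfers a z).card : ℝ) * gainT Λ.P ≤
      Φ.collisionSum (Set.Ioc 0 Λ.w)
        (fun c => ω c.fst * ω c.snd * ((phi c.fstPos - phi c.sndPos) * ((‖c.postVel.1‖ ^ 2 - ‖c.preVel.1‖ ^ 2) / 2)) / 2) z := by
  rw [energy_window_eq hW hε hz hgood hω phi]
  calc ((Λ.transfers a z).card : ℝ) * gainT Λ.P = ∑ _tr ∈ Λ.transfers a z, gainT Λ.P := by
        rw [Finset.sum_const, nsmul_eq_mul]
    _ ≤ _ := Finset.sum_le_sum fun tr htr => gain_transfer hW hG hz htr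

open Classical in
/-- **Counting transfers**: at least `(#active blocks) · n² · kw`. [folklore] -/
theorem card_transfers_ge (hΛ : Λ.OK) {z : Cfg N} (hz : z ∈ Λ.Ev a) {kw : ℕ} (hkK : kw + 1 ≤ Λ.P.K)
    (hkw : (kw : ℝ) * Λ.P.θhi ≤ Λ.w) :
    ((Finset.range Λ.Q).filter Λ.Active).card * (Λ.n * Λ.n) * kw ≤ (Λ.transfers a z).card := by
  classical
  have hP := hΛ.sep.adm
  set S := ((Finset.range Λ.Q).filter Λ.Active) ×ˢ ((Finset.univ : Finset (Fin Λ.n × Fin Λ.n)) ×ˢ Finset.range kw)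
  have hsub : S ⊆ Λ.transfers a z := by
    intro tr htr
    simp only [S, Finset.mem_product, Finset.mem_filter, Finset.mem_range, Finset.mem_univ, true_and] at htr
    obtain ⟨⟨hb, hact⟩, hj⟩ := htr
    refine mem_transfers.2 ⟨hb, by omega, hact, ?_⟩
    have hD := dataOK_of_mem hΛ hz hact tr.2.1
    have ht := (inv_all hP hD (tr.2.2 + 1) (by omega)).t_le
    calc Λ.ttime a z tr = tHit Λ.P (bv 0) (Λ.bdata a z tr.1 tr.2.1) (tr.2.2 + 1) := rfl
      _ ≤ ((tr.2.2 + 1 : ℕ) : ℝ) * Λ.P.θhi := ht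
      _ ≤ (kw : ℝ) * Λ.P.θhi := by
          refine mul_le_mul_of_nonneg_right ?_ hP.θhi_pos.le; exact_mod_cast hj
      _ ≤ Λ.w := hkw
  calc ((Finset.range Λ.Q).filter Λ.Active).card * (Λ.n * Λ.n) * kw = S.card := by
        simp only [S, Finset.card_product, Finset.card_univ, Fintype.card_prod, Fintype.card_fin, Finset.card_range]
        ring
    _ ≤ _ := Finset.card_le_card hsub

end Lat

end Energy

end EquilibriumClampedCollisionalWindowLDNegative

end Summit.AtomisticToContinuum.HydrodynamicLimit.Theorems

end
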